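/-
Copyright (c) 2026. Released under Apache 2.0 license.
-/
import Literature.AlgebraicGeometry.ShimuraVarieties.UnitaryBallCauchyRiemann
import Literature.RepresentationTheory.KonnoKonno2007.RealUnitaryDualPairBallFrame
import Literature.RepresentationTheory.KonnoKonno2007.RealUnitaryRankOneKAK
import HarnessLib

/-!
# The boost dictionary of the ball frame: `expP ((c t) • e_p)` in `U(2,1)_{Fin 2 ⊕ Unit}`

[folklore] For the ball model `U21 ⊂ GL₃(ℂ)` of `UnitBallU21` with its exponential `𝔭`-coordinates
`expP b = exp X_b`, `X_b = [[0, b],[b^*, 0]]` (`UnitaryBallCauchyRiemann`), and the BALL FRAME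
`u21FrameEquiv : U21 ≃ₜ* UForm (Fin 2) Unit` (`0, 1 ↦ inl 0, inl 1`, `2 ↦ inr ()`;
`RealUnitaryDualPairBallFrame`), this file computes the one-parameter boosts in CLOSED FORM:
for a unit phase `c` (`c̄ c = 1`), a coordinate `p : Fin 2` and `t : ℝ`,

* `exp_pMat_phase_single` — `exp X_{(c t) e_p} = boostMat p c t`, the matrix with `cosh t` at `(p,p)`, `(2,2)`,
  `c sinh t` at `(p,2)`, `c̄ sinh t` at `(2,p)`, `1` at the remaining diagonal entry (diagonalisation
  `X_{c e_p} = R · diag(1, -1 | 0) · R⁻¹`, `R = [[c, c],[1, -1]]` on the plane `{p, 2}`, then Mathlib's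
  `Matrix.exp_conj` and `Matrix.exp_diagonal`);
* `coe_u21FrameEquiv_expP_phase` — in the ball frame,
  `u21FrameEquiv (expP ((c t) • e_p)) = plant p () [[cosh t, c sinh t],[c̄ sinh t, cosh t]]`;
* `coe_u21FrameEquiv_expP_real` (`c = 1`) — `expP (t • e_p)` is the REAL symmetric boost
  `plant p () [[cosh t, sinh t],[sinh t, cosh t]]`;
* `u21FrameEquiv_expP_negI` (`c = -I`) — `u21FrameEquiv (expP ((-I t) • e_p)) = hypV p () t`, the rank-one
  hyperbolic one-parameter subgroup of `RealUnitaryRankOneKAK`, on the nose (equality in `UForm (Fin 2) Unit`);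
  `u21FrameEquiv_expP_I` (`c = I`) — `u21FrameEquiv (expP ((I t) • e_p)) = hypV p () (-t)`.

This is the group-side half of the dictionary between the `𝔭`-directional derivatives
`t ↦ F (g · expP (t • b))` of `UnitaryBallCauchyRiemann` / `UnitaryBallHolomorphyCriterion` and the
`K A K` one-parameter subgroups `hypV` (and their `K`-conjugates) over which representation-side symbol
formulas are stated; all statements are kernel-proved matrix identities, no records, no new hypotheses.

References: [folklore]; matrix exponential, `exp (U A U⁻¹) = U (exp A) U⁻¹`, `exp (diag v) = diag (exp v)`:
Mathlib `Mathlib.Analysis.Normed.Algebra.MatrixExponential`. Prototype (`SL₂(ℝ)`, `exp t[[0,1],[1,0]] =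
[[cosh t, sinh t],[sinh t, cosh t]]`): D. Bump, *Automorphic Forms and Representations* (1997) §2.1–§3.2;
the frame `U(2,1) × U(1)` as in K. Konno, T. Konno, Kyushu J. Math. 61 (2007) §3.1.

Provenance. Written under the LEAN-IN-TREE rule for the pub-hodgecm formalisation cell (seat pv08, desk ruling
(EEE′): «W6b-hol» dictionary, boost half); nothing here is a claim of the manuscripts adjudicated by that cell.
-/

set_option autoImplicit false

noncomputable section

open scoped Matrix Matrix.Norms.Operator ComplexConjugate
open Complex (I)
open Literature.Geometry.ComplexHyperbolic Literature.Geometry.ComplexHyperbolic.BallModel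
open Literature.AlgebraicGeometry.ShimuraVarieties Literature.AlgebraicGeometry.ShimuraVarieties.BallForms

namespace Literature.RepresentationTheory.KonnoKonno2007

namespace RealDualPair

/-- The phase-`c` boost matrix on the plane `{p, 2}` of `ℂ³`: `cosh t` at `(p,p)`, `(2,2)`, `c·sinh t` at `(p,2)`,
`c̄·sinh t` at `(2,p)`, `1` at `(q,q)` for the other index `q`, `0` elsewhere. [folklore] -/
def boostMat (p : Fin 2) (c : ℂ) (t : ℝ) : Matrix (Fin 3) (Fin 3) ℂ :=
  Matrix.of fun i j =>
    if i = p.castSucc then (if j = p.castSucc then (Real.cosh t : ℂ) else if j = 2 then c * (Real.sinh t : ℂ) else 0)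
    else if i = 2 then (if j = p.castSucc then conj c * (Real.sinh t : ℂ) else if j = 2 then (Real.cosh t : ℂ) else 0)
    else (if j = i then 1 else 0)

/-- frame matrix diagonalising `X_{c e_p}` (`|c| = 1`): `[[c, c],[1, -1]]` planted on `{p, 2}` (columns = the
eigenvectors `(c, 1)`, `(c, -1)` of `[[0, c],[c̄, 0]]` for the eigenvalues `1`, `-1`). [folklore] -/
def boostFrame (p : Fin 2) (c : ℂ) : Matrix (Fin 3) (Fin 3) ℂ :=
  Matrix.of fun i j =>
    if i = p.castSucc then (if j = p.castSucc then c else if j = 2 then c else 0)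
    else if i = 2 then (if j = p.castSucc then 1 else if j = 2 then -1 else 0)
    else (if j = i then 1 else 0)

/-- its inverse for `c̄ c = 1`: `[[c̄/2, 1/2],[c̄/2, -1/2]]` planted on `{p, 2}`. [folklore] -/
def boostFrameInv (p : Fin 2) (c : ℂ) : Matrix (Fin 3) (Fin 3) ℂ :=
  Matrix.of fun i j =>
    if i = p.castSucc then (if j = p.castSucc then conj c / 2 else if j = 2 then 1 / 2 else 0)
    else if i = 2 then (if j = p.castSucc then conj c / 2 else if j = 2 then -1 / 2 else 0)
    else (if j = i then 1 else 0)

/-- the eigenvalues: `t`, `-t` on the plane `{p, 2}`, `0` on the other index. [folklore] -/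
def boostDiag (p : Fin 2) (t : ℝ) : Fin 3 → ℂ :=
  fun i => if i = p.castSucc then (t : ℂ) else if i = 2 then -(t : ℂ) else 0

/-- `R · R⁻¹ = 1` for `c̄ c = 1`. [folklore] -/
theorem boostFrame_mul_inv (p : Fin 2) {c : ℂ} (hc : conj c * c = 1) : boostFrame p c * boostFrameInv p c = 1 := by
  ext i j
  fin_cases p <;> fin_cases i <;> fin_cases j <;>
    simp [boostFrame, boostFrameInv, Matrix.mul_apply, Fin.sum_univ_three] <;>
    (first | ring1 | linear_combination hc)

/-- `R` is invertible for `c̄ c = 1`. [folklore] -/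
theorem isUnit_boostFrame (p : Fin 2) {c : ℂ} (hc : conj c * c = 1) : IsUnit (boostFrame p c) :=
  letI := invertibleOfRightInverse _ _ (boostFrame_mul_inv p hc)
  isUnit_of_invertible _

/-- the nonsingular inverse of `R` is `boostFrameInv` (`c̄ c = 1`). [folklore] -/
theorem boostFrame_inv (p : Fin 2) {c : ℂ} (hc : conj c * c = 1) : (boostFrame p c)⁻¹ = boostFrameInv p c :=
  Matrix.inv_eq_right_inv (boostFrame_mul_inv p hc)

/-- `X_{(c t) e_p} = R · diag(t, -t | 0) · R⁻¹`. [folklore] -/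
theorem pMat_phase_single_eq_conj (p : Fin 2) {c : ℂ} (hc : conj c * c = 1) (t : ℝ) :
    pMat ((c * (t : ℂ)) • (Pi.single p 1 : Fin 2 → ℂ)) =
      boostFrame p c * Matrix.diagonal (boostDiag p t) * (boostFrame p c)⁻¹ := by
  rw [boostFrame_inv p hc]
  ext i j
  fin_cases p <;> fin_cases i <;> fin_cases j <;>
    simp [pMat, boostFrame, boostFrameInv, boostDiag, Matrix.mul_apply, Fin.sum_univ_three,
      Matrix.diagonal] <;> ring

/-- **Closed form of the phase-`c` boost** (`c̄ c = 1`): `exp X_{(c t) e_p} = boostMat p c t`. [folklore] -/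
theorem exp_pMat_phase_single (p : Fin 2) {c : ℂ} (hc : conj c * c = 1) (t : ℝ) :
    NormedSpace.exp (pMat ((c * (t : ℂ)) • (Pi.single p 1 : Fin 2 → ℂ))) = boostMat p c t := by
  have hexp : ∀ z : ℂ, NormedSpace.exp z = Complex.exp z := fun z => by rw [Complex.exp_eq_exp_ℂ]
  rw [pMat_phase_single_eq_conj p hc, Matrix.exp_conj _ _ (isUnit_boostFrame p hc), Matrix.exp_diagonal,
    boostFrame_inv p hc, Pi.exp_def]
  ext i j
  fin_cases p <;> fin_cases i <;> fin_cases j <;>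
    simp [boostMat, boostFrame, boostFrameInv, boostDiag, Matrix.mul_apply, Fin.sum_univ_three,
      Matrix.diagonal, hexp, Real.cosh_eq, Real.sinh_eq, Complex.ofReal_exp] <;>
    (first | ring1 | linear_combination ((Complex.exp (t : ℂ) + Complex.exp (-(t : ℂ))) / 2) * hc)

/-- matrix of `expP ((c t) • e_p)`. [folklore] -/
theorem mat_expP_phase_single (p : Fin 2) {c : ℂ} (hc : conj c * c = 1) (t : ℝ) :
    mat (expP ((c * (t : ℂ)) • (Pi.single p 1 : Fin 2 → ℂ))) = boostMat p c t := by
  rw [mat_expP, exp_pMat_phase_single p hc]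

/-- **The boost dictionary** (`c̄ c = 1`): in the ball frame, `expP ((c t) • e_p)` is
`plant p () [[cosh t, c·sinh t],[c̄·sinh t, cosh t]]`. [folklore] -/
theorem coe_u21FrameEquiv_expP_phase (p : Fin 2) {c : ℂ} (hc : conj c * c = 1) (t : ℝ) :
    (((u21FrameEquiv (expP ((c * (t : ℂ)) • (Pi.single p 1 : Fin 2 → ℂ))) : UForm (Fin 2) Unit) :
        GL (Fin 2 ⊕ Unit) ℂ) : Matrix (Fin 2 ⊕ Unit) (Fin 2 ⊕ Unit) ℂ) =
      plant p () !![(Real.cosh t : ℂ), c * (Real.sinh t : ℂ); conj c * (Real.sinh t : ℂ), (Real.cosh t : ℂ)] := by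
  ext x y
  rw [coe_u21FrameEquiv_apply, mat_expP_phase_single p hc]
  rcases x with i | ⟨⟩ <;> rcases y with j | ⟨⟩
  · fin_cases p <;> fin_cases i <;> fin_cases j <;> simp [boostMat]
  · fin_cases p <;> fin_cases i <;> simp [boostMat]
  · fin_cases p <;> fin_cases j <;> simp [boostMat]
  · fin_cases p <;> simp [boostMat]

/-- `c = 1`: `expP (t • e_p)` is the REAL symmetric boost `plant p () [[cosh t, sinh t],[sinh t, cosh t]]`. [folklore] -/
theorem coe_u21FrameEquiv_expP_real (p : Fin 2) (t : ℝ) :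
    (((u21FrameEquiv (expP ((t : ℂ) • (Pi.single p 1 : Fin 2 → ℂ))) : UForm (Fin 2) Unit) :
        GL (Fin 2 ⊕ Unit) ℂ) : Matrix (Fin 2 ⊕ Unit) (Fin 2 ⊕ Unit) ℂ) =
      plant p () !![(Real.cosh t : ℂ), (Real.sinh t : ℂ); (Real.sinh t : ℂ), (Real.cosh t : ℂ)] := by
  have h := coe_u21FrameEquiv_expP_phase p (c := 1) (by simp) t
  simp only [one_mul, map_one] at h
  exact h

/-- `c = -I`: `expP ((-I t) • e_p)` is `hypV p () t` on the nose. [folklore] -/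
theorem u21FrameEquiv_expP_negI (p : Fin 2) (t : ℝ) :
    (u21FrameEquiv (expP ((-I * (t : ℂ)) • (Pi.single p 1 : Fin 2 → ℂ))) : UForm (Fin 2) Unit) = hypV p () t := by
  have hc : conj (-I) * (-I) = 1 := by simp
  apply Subtype.ext
  apply Units.ext
  rw [coe_u21FrameEquiv_expP_phase p hc, coe_hypV]
  congr 1
  ext i j
  fin_cases i <;> fin_cases j <;> simp <;> ring

/-- `c = I`: `expP ((I t) • e_p)` is `hypV p () (-t)`. [folklore] -/
theorem u21FrameEquiv_expP_I (p : Fin 2) (t : ℝ) :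
    (u21FrameEquiv (expP ((I * (t : ℂ)) • (Pi.single p 1 : Fin 2 → ℂ))) : UForm (Fin 2) Unit) = hypV p () (-t) := by
  have hc : conj I * I = 1 := by simp
  apply Subtype.ext
  apply Units.ext
  rw [coe_u21FrameEquiv_expP_phase p hc, coe_hypV]
  congr 1
  ext i j
  fin_cases i <;> fin_cases j <;> simp [Real.cosh_neg, Real.sinh_neg] <;> ring

end RealDualPair

end Literature.RepresentationTheory.KonnoKonno2007

end
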